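import Summits.ResolutionOfSingularities.ResolutionOfSingularities.Theorems.PurelyInseparableDim4ResConeBInfEntryFrame
import Summits.ResolutionOfSingularities.ResolutionOfSingularities.Theorems.PurelyInseparableDim4ResConeFourWeights
import Summits.ResolutionOfSingularities.ResolutionOfSingularities.Theorems.PurelyInseparableDim4PhiLineSupercritical
import HarnessLib
import HarnessLib.Audit.Tags

/-!
# Purely inseparable four-folds — STUB E₄ of the D∞ heavy-line assembly at `(p, d) = (5, 4)`: the ENTRY FRAME at a
# `(2,1)`-state (K2(p) lane, slice C `(5,4)`, desk WORD #182 (ii) «re-presentation-free heavy line»; cell `res-dim4-pi`)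

[OURS · counted 0 · cell `res-dim4-pi` · text of record = res-dim4-p-7 g5's EntryInv₄/RunInv₄ (bus 2026-08-29 07:29:46Z), ADOPTED
by res-dim4-idea-1 g8 (07:38:45Z, CARD I-1-10 frame discipline): `μ = 4`, `u₁ = x_W` the HEAVY letter (`r_W = 2`), label
polygon `pts ≠ ∅ ∧ 4! < δs ∧ 2·αs ≤ 4!`; E₄ = p-9 g4 (desk WORD #182 (ii)); K₄ + assembly `…DInfPotential` = res-dim4-p-7 g5; L₄ =
res-dim4-p-2 g5; Φ-inputs res-dim4-p-11 g5 (`…PhiLineSupercritical.mul_alphaS_le_of_isIsolated`).  The `μ = 3` twin is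
`…ResConeBInfEntryFrame.stub_entryFrame` (p702794); this file transposes it.]  Nothing here proves K2(p)/K2(5), TAIL-D, the β_h
line, or resolution of singularities in dimension ≥ 4 / characteristic `p`.  AI kernel work, weaker than expert review.

THE STUB: on TAIL-D data (isolated witnessed `Step0 5` chain, `x^{r₀} ∣ F₀`, off the floor, shade `4` and `e_G = 2` from `k₀`), at a
`(2,1)`-state `k ≥ k₀` of the heavy class (`|r_k| = 3`, heavy letter `W`, `r_k W = 2`; W₄ `dInf_pattern`: the step HITS `W`) there is
a linear frame `L` with left inverse `M`, `L u₁ = e_W`, y-rows annihilating `resVertex (c k)`, and the `μ = 4` polygon of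
`(G_k / 1)` has `pts ≠ ∅`, `4! < δs`, `2·αs ≤ 4!`.
* §1 degree-generic label lemmas `label_of_dual_columns_pow`, `residual_mem_label_deg` (the `μ = 3` ones hard-code `3`);
* §2 **`stub_entryFrame₄`** — dual columns (`exists_dualColumns`, transversality from `dInf_pattern`), explicit inverse
  (`entryRows_mul`), `2·αs ≤ 4!` from (K-Φ1)-n `PhiLine.mul_alphaS_le_of_isIsolated` (`n = p − r_W = 3`: `4·αs ≤ 2·4!`), `4! < δs`
  from the quartic residual cone (degree `4 < 5`, tame) via `label_of_dual_columns_pow`.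
[cite: CossartJannsenSaito2020, Def. 8.2, Def. 8.4, Lemma 12.2 (2)] [cite: CossartPiltant2008, §4 p. 11] [cite: Hironaka1970AdditiveGroups, §1]
bears_on: LADDER-RESOLUTION:D157-DOOR2 (res-dim4-pi · K2(p) · slice C (5,4) heavy line, stub E₄).  Supports
stmt-ResolutionOfSingularities-16155 (helper).
-/

set_option linter.dupNamespace false -- mandated namespace of this single-conjunct summit

noncomputable section

namespace Summit.ResolutionOfSingularities.ResolutionOfSingularities.Theorems.PIDim4

namespace ResCone

open MvPolynomial Finset IsLocalRing
open Literature.AlgebraicGeometry.Resolution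
open Literature.AlgebraicGeometry.Resolution.CentreBlowup
open Literature.AlgebraicGeometry.Resolution.Hauser2010
open Literature.AlgebraicGeometry.Resolution.HauserPerlega2019
open Literature.AlgebraicGeometry.Resolution.WeightedOrder
open PointBlowup (additiveSubspace direction)

variable {K : Type} [Field K]

/-! ## 1. Degree-generic label lemmas -/

section Label

/-- **THE LABEL LEMMA, any level `n`**: as `label_of_dual_columns` (the `n = 3` case) — a polynomial `g ∈ 𝔪₀ⁿ` of total degree
`< 5 = char K` whose polar kernel contains the two `u`-columns of the dual basis lies in `(ℓ_{y₁}, ℓ_{y₂})ⁿ`. [OURS]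
[cite: Hironaka1970AdditiveGroups, §1] [cite: CossartJannsenSaito2020, Def. 8.4] -/
theorem label_of_dual_columns_pow [CharP K 5] (n : ℕ) {L : Fin (2 + 2) → Fin 4 → K} {M : Fin 4 → Fin (2 + 2) → K}
    (hM : ∀ t u, ∑ i, M t i * L i u = if t = u then 1 else 0) {g : MvPolynomial (Fin 4) K}
    (hg3 : g ∈ MvPolynomial.idealOfVars (Fin 4) K ^ n) (hdeg : g.totalDegree < 5)
    (hu1 : (fun t => M t (u1 2)) ∈ additiveSubspace g) (hu2 : (fun t => M t (u2 2)) ∈ additiveSubspace g) :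
    g ∈ Ideal.span (Set.range fun i : Fin 2 =>
      (∑ s, C (L (Fin.castAdd 2 i) s) * X s : MvPolynomial (Fin 4) K)) ^ n := by
  classical
  set ℓ : Fin (2 + 2) → MvPolynomial (Fin 4) K := fun i => ∑ s, C (L i s) * X s with hℓ
  set I : Ideal (MvPolynomial (Fin 4) K) := Ideal.span (Set.range fun i : Fin 2 =>
    (∑ s, C (L (Fin.castAdd 2 i) s) * X s : MvPolynomial (Fin 4) K)) with hI
  set y : Fin 4 → MvPolynomial (Fin 4) K := fun t => C (M t 0) * ℓ 0 + C (M t 1) * ℓ 1 with hy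
  -- the identity substitution, split into y-part and u-part
  have hsplit : (fun t => (X t : MvPolynomial (Fin 4) K)) =
      fun t => y t + ∑ i ∈ ({u1 2, u2 2} : Finset (Fin (2 + 2))),
        algebraMap K (MvPolynomial (Fin 4) K) ((fun i : Fin (2 + 2) => fun t : Fin 4 => M t i) i t) * ℓ i := by
    funext t
    rw [X_eq_sum_C_mul_linearForm hM t, sum_frameIndex, Finset.sum_pair frameIndex_ne.2.2.2.2.2, hy]
    simp only [MvPolynomial.algebraMap_eq, hℓ]
    ring
  have hinv : aeval y g = g := by
    have h := PhiLine.aeval_add_sum_mul_eq_aeval 5 hdeg ({u1 2, u2 2} : Finset (Fin (2 + 2)))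
      (t := fun i : Fin (2 + 2) => fun t : Fin 4 => M t i) (fun i hi => by
        rcases Finset.mem_insert.mp hi with h | h
        · rw [h]; exact hu1
        · rw [Finset.mem_singleton.mp h]; exact hu2) y ℓ
    rw [← hsplit, aeval_X_left_apply] at h
    exact h.symm
  -- `aeval y` maps `𝔪₀` into `I`, hence `𝔪₀³` into `I³`
  have hmap : Ideal.map (aeval y).toRingHom (MvPolynomial.idealOfVars (Fin 4) K) ≤ I := by
    rw [MvPolynomial.idealOfVars, Ideal.map_span, Ideal.span_le]
    rintro _ ⟨_, ⟨t, rfl⟩, rfl⟩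
    rw [AlgHom.toRingHom_eq_coe, RingHom.coe_coe, aeval_X, hy]
    refine I.add_mem (I.mul_mem_left _ (Ideal.subset_span ⟨0, rfl⟩)) (I.mul_mem_left _ (Ideal.subset_span ⟨1, rfl⟩))
  rw [← hinv]
  have hmem : aeval y g ∈ Ideal.map (aeval y).toRingHom (MvPolynomial.idealOfVars (Fin 4) K ^ n) :=
    Ideal.mem_map_of_mem _ hg3
  rw [Ideal.map_pow] at hmem
  exact Ideal.pow_right_mono hmap n hmem


/-- **The residual polynomial carries the label, any shade `d`**: `ord₀ F = |r| + d` and `resForm s ∈ I^d` give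
`G = F / x^r ∈ I^d ⊔ 𝔪₀^{d+1}`. [OURS] [cite: CossartJannsenSaito2020, Def. 8.4] -/
theorem residual_mem_label_deg (d : ℕ) {s : State K} (ho : ordZero s.F = ((s.r.degree + d : ℕ) : ℕ∞))
    {I : Ideal (MvPolynomial (Fin 4) K)} (hform : resForm s ∈ I ^ d) :
    s.F.divMonomial s.r ∈ I ^ d ⊔ Literature.AlgebraicGeometry.Resolution.originIdeal K 4 ^ (d + 1) := by
  have hsplit : s.F.divMonomial s.r = resForm s + (s.F.divMonomial s.r - resForm s) := by ring
  rw [hsplit]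
  refine Ideal.add_mem _ (Ideal.mem_sup_left hform) (Ideal.mem_sup_right ?_)
  rw [PhiLine.originIdeal_eq_idealOfVars, MvPolynomial.mem_pow_idealOfVars_iff']
  intro x hd
  rw [coeff_sub, coeff_divMonomial, coeff_resForm]
  by_cases h3 : x.degree = d
  · rw [NarrowApolarity.coeff_initialForm_of_degree_eq ho (by rw [map_add, h3]), sub_self]
  · have hlt : (s.r + x).degree < s.r.degree + d := by rw [map_add]; omega
    have hF : coeff (s.r + x) s.F = 0 := ((ordZero_eq_nat_iff _ _).mp ho).2 _ hlt
    have hin : coeff (s.r + x) (initialForm s.F) = 0 := by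
      by_contra hne
      exact absurd (support_initialForm_subset s.F (MvPolynomial.mem_support_iff.mpr hne))
        (by rw [MvPolynomial.mem_support_iff, not_not]; exact hF)
    rw [hF, hin, sub_self]


end Label

/-! ## 2. STUB E₄: the entry frame at a `(2,1)`-state of the D∞ heavy class -/

section Entry

variable [CharP K 5] [DecidableEq K]

/-- **STUB E₄ — THE ENTRY FRAME AT A `(2,1)`-STATE OF THE D∞ HEAVY CLASS** (res-dim4-p-7 g5's EntryInv₄ unfolded, `μ = 4`).
On TAIL-D data (isolated witnessed `Step0 5` chain, `x^{r₀} ∣ F₀`, off the floor, shade `4` and `e_G = 2` from `k₀`), at a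
`(2,1)`-state `k ≥ k₀` (`|r_k| = 3`) with heavy letter `W` (`r_k W = 2`) there is a linear frame `L : Fin (2+2) → Fin 4 → K` with left
inverse `M` such that `L u₁ = e_W`, the y-rows annihilate `resVertex (c k)`, and the `μ = 4` polygon of `(G_k / 1)` in the frame
of `𝒪 = K[x]_{(x)}` attached to `L` has `pts ≠ ∅`, `4! < δs` and `2·αs ≤ 4!`.  Transversality: the `(2,1)`-step HITS `W` (W₄
`dInf_pattern`), so the step direction (`chain_direction_mem_resVertex`) has `w_W ≠ 0`; frame and inverse by `exists_dualColumns`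
+ `entryRows_mul`; `2·αs ≤ 4!` by (K-Φ1)-n `PhiLine.mul_alphaS_le_of_isIsolated` with `n = 3 = p − r_W`; `4! < δs` by
`label_of_dual_columns_pow 4` + `PhiLine.factorial_lt_deltaS_span_singleton_iff`. [OURS]
[cite: CossartJannsenSaito2020, Def. 8.4, Lemma 12.2 (2)] [cite: CossartPiltant2008, §4 p. 11] -/
theorem stub_entryFrame₄ {c : ℕ → State K} {j : ℕ → Fin 4} {b : ℕ → Fin 4 → K}
    (hc : ∀ k, IsIsolated 5 (c k).F ∧ Step0 5 (c k) (c (k + 1))) (hw : FreeTail.IsWitnessedChain 5 c j b)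
    (hr0 : ∀ e ∈ (c 0).F.support, (c 0).r ≤ e) (hfloor : ∀ k, ordZero (c k).F ≠ 5) {k₀ : ℕ}
    (hshade : ∀ k, k₀ ≤ k → (c k).shade = ((4 : ℕ) : ℕ∞))
    (he : ∀ k, k₀ ≤ k → Module.finrank K (resVertex (c k)) = 2)
    {k : ℕ} (hk : k₀ ≤ k) (h3 : (c k).r.degree = 3) {W : Fin 4} (hW : (c k).r W = 2) :
    ∃ (L : Fin (2 + 2) → Fin 4 → K) (M : Fin 4 → Fin (2 + 2) → K),
      (∀ t u, ∑ i, M t i * L i u = if t = u then 1 else 0) ∧ L (u1 2) = Pi.single W 1 ∧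
      (∀ i, i ≠ u1 2 → i ≠ u2 2 → ∀ w ∈ resVertex (c k), ∑ t, L i t * w t = 0) ∧ (c k).r W = 2 ∧
      (pts (fun i => algebraMap (MvPolynomial (Fin 4) K) (OriginLocalization K 4) (∑ t, C (L i t) * X t))
        (Ideal.span {algebraMap (MvPolynomial (Fin 4) K) (OriginLocalization K 4)
          ((c k).F.divMonomial (c k).r)}) 4).Nonempty ∧
      Nat.factorial 4 < deltaS (fun i => algebraMap (MvPolynomial (Fin 4) K) (OriginLocalization K 4)
        (∑ t, C (L i t) * X t)) (Ideal.span {algebraMap (MvPolynomial (Fin 4) K) (OriginLocalization K 4)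
          ((c k).F.divMonomial (c k).r)}) 4 ∧
      2 * alphaS (fun i => algebraMap (MvPolynomial (Fin 4) K) (OriginLocalization K 4) (∑ t, C (L i t) * X t))
        (Ideal.span {algebraMap (MvPolynomial (Fin 4) K) (OriginLocalization K 4)
          ((c k).F.divMonomial (c k).r)}) 4 ≤ Nat.factorial 4 := by
  haveI : Fact (Nat.Prime 5) := ⟨by norm_num⟩
  obtain ⟨hord, -, -, -, -⟩ := four_weights_laws hc hw hr0 hfloor hshade
  have ho := hord k hk
  have hrk := IsolatedBand.isolated_chain_forall_le hc hr0 k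
  have hF : (c k).F = monomial (c k).r 1 * (c k).F.divMonomial (c k).r := eq_monomial_mul_divMonomial hrk
  -- the step direction is in the polar kernel and is transversal to `{w_W = 0}`
  have hdir : direction (j k) (b k) ∈ resVertex (c k) := chain_direction_mem_resVertex 5 hc hw hr0 hfloor hshade hk
  have hdirW : direction (j k) (b k) W ≠ 0 := by
    have hhit := ((dInf_pattern hc hw hr0 hfloor hshade hk hW).2.1 h3).1
    by_cases hj : j k = W
    · rw [← hj, direction_apply_self]; exact one_ne_zero
    · unfold direction
      rw [Function.update_of_ne (Ne.symm hj)]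
      exact hhit.resolve_left hj
  -- dual columns and the two other letters
  obtain ⟨m, m₃, m₄, hmW, hm₃V, hm₄V, h₃W, h₃m, h₄W, h₄m⟩ := exists_dualColumns (he k hk) hdir hdirW
  obtain ⟨a, a', haW, ham, ha'W, ha'm, haa', hall⟩ := exists_two_other_letters (Ne.symm hmW)
  -- the frame and its inverse
  set rowA : Fin 4 → K := fun u =>
    (Pi.single a 1 : Fin 4 → K) u - m₃ a * (Pi.single W 1 : Fin 4 → K) u - m₄ a * (Pi.single m 1 : Fin 4 → K) u with hrowA
  set rowA' : Fin 4 → K := fun u =>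
    (Pi.single a' 1 : Fin 4 → K) u - m₃ a' * (Pi.single W 1 : Fin 4 → K) u - m₄ a' * (Pi.single m 1 : Fin 4 → K) u with hrowA'
  set L : Fin (2 + 2) → Fin 4 → K := fun i =>
    if i = u1 2 then Pi.single W 1 else if i = u2 2 then Pi.single m 1 else if i = 0 then rowA else rowA' with hL
  set M : Fin 4 → Fin (2 + 2) → K := fun t i =>
    if i = u1 2 then m₃ t else if i = u2 2 then m₄ t else if i = 0 then (Pi.single a 1 : Fin 4 → K) t
      else (Pi.single a' 1 : Fin 4 → K) t with hM
  obtain ⟨h0u1, h0u2, h1u1, h1u2, h01, hu12⟩ := frameIndex_ne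
  have hLu1 : L (u1 2) = Pi.single W 1 := by rw [hL]; exact if_pos rfl
  have hLu2 : L (u2 2) = Pi.single m 1 := by rw [hL]; simp only [if_neg (Ne.symm hu12), if_pos]
  have hL0 : L 0 = rowA := by rw [hL]; simp only [if_neg h0u1, if_neg h0u2, if_pos]
  have hL1 : L 1 = rowA' := by rw [hL]; simp only [if_neg h1u1, if_neg h1u2, if_neg (Ne.symm h01)]
  have hMu1 : ∀ t, M t (u1 2) = m₃ t := fun t => by rw [hM]; exact if_pos rfl
  have hMu2 : ∀ t, M t (u2 2) = m₄ t := fun t => by rw [hM]; simp only [if_neg (Ne.symm hu12), if_pos]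
  have hM0 : ∀ t, M t 0 = (Pi.single a 1 : Fin 4 → K) t := fun t => by rw [hM]; simp only [if_neg h0u1, if_neg h0u2, if_pos]
  have hM1 : ∀ t, M t 1 = (Pi.single a' 1 : Fin 4 → K) t := fun t => by
    rw [hM]; simp only [if_neg h1u1, if_neg h1u2, if_neg (Ne.symm h01)]
  have hinv : ∀ t u, ∑ i, M t i * L i u = if t = u then 1 else 0 := by
    intro t u
    rw [sum_frameIndex, hM0, hM1, hMu1, hMu2, hL0, hL1, hLu1, hLu2]
    exact entryRows_mul haW ham ha'W ha'm haa' (Ne.symm hmW) hall h₃W h₃m h₄W h₄m t u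
  -- the y-rows annihilate the polar kernel
  have hy : ∀ i, i ≠ u1 2 → i ≠ u2 2 → ∀ w ∈ resVertex (c k), ∑ t, L i t * w t = 0 := by
    intro i hi1 hi2 w hwV
    have hdec := apply_eq_of_mem_plane (he k hk) hm₃V hm₄V h₃W h₃m h₄W h₄m hwV
    rcases frameIndex_cases i with hi | hi | hi | hi
    · rw [hi, hL0, hrowA, entryRow_dot, hdec a, hdec W, hdec m, h₃W, h₃m, h₄W, h₄m]; ring
    · rw [hi, hL1, hrowA', entryRow_dot, hdec a', hdec W, hdec m, h₃W, h₃m, h₄W, h₄m]; ring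
    · exact absurd hi hi1
    · exact absurd hi hi2
  -- polygon data in `𝒪`
  have hgen := PhiLine.span_range_linearFrame_eq_maximalIdeal L M hinv
  have hdim := PhiLine.ringKrullDim_originLocalization_two_add_two (K := K)
  have hu1' : (fun i => algebraMap (MvPolynomial (Fin 4) K) (OriginLocalization K 4) (∑ t, C (L i t) * X t)) (u1 2) =
      algebraMap (MvPolynomial (Fin 4) K) (OriginLocalization K 4) (X W) := by
    show algebraMap _ _ (∑ t, C (L (u1 2) t) * X t) = _
    rw [hLu1, PhiLine.sum_C_single_mul_X]
  obtain ⟨hne, hα⟩ := PhiLine.mul_alphaS_le_of_isIsolated (d := 4) (n := 3) hF (hc k).1 (h := W) (by omega) (by omega)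
    _ hgen hu1'
  refine ⟨L, M, hinv, hLu1, hy, hW, hne, ?_, by rw [Nat.factorial] at hα ⊢; omega⟩
  -- the label: `G ∈ (ℓ_y)³ ⊔ 𝔪₀⁴`
  have hhom : (resForm (c k)).IsHomogeneous 4 := by
    have h := resForm_isHomogeneous ho
    rwa [show (c k).r.degree + 4 - (c k).r.degree = 4 by omega] at h
  have hg3 : resForm (c k) ∈ MvPolynomial.idealOfVars (Fin 4) K ^ 4 := by
    rw [MvPolynomial.mem_pow_idealOfVars_iff']
    intro x hx
    by_contra hne'
    have := hhom hne'
    rw [weight_one_eq_degree] at this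
    omega
  have hcol1 : (fun t => M t (u1 2)) ∈ additiveSubspace (resForm (c k)) := by
    rw [show (fun t => M t (u1 2)) = m₃ from funext hMu1]; exact hm₃V
  have hcol2 : (fun t => M t (u2 2)) ∈ additiveSubspace (resForm (c k)) := by
    rw [show (fun t => M t (u2 2)) = m₄ from funext hMu2]; exact hm₄V
  have hlabel := residual_mem_label_deg 4 ho
    (label_of_dual_columns_pow 4 hinv hg3 (lt_of_le_of_lt hhom.totalDegree_le (by norm_num)) hcol1 hcol2)
  exact (PhiLine.factorial_lt_deltaS_span_singleton_iff _ 4 hgen hdim hne).mpr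
    (PhiLine.algebraMap_mem_yIdeal_pow_sup L hlabel)


end Entry

end ResCone

end Summit.ResolutionOfSingularities.ResolutionOfSingularities.Theorems.PIDim4

end
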